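import Summits.HubbardSuperconductivity.HubbardSuperconductivity.Theorems.AnisotropyChordTransferFibre3FinXBCover

/-!
# Route `AnisotropyChord` / H0 rotor rung: FIN exact-block row-`N₁` certificate at `L = 12` — cell facts, part `c`

Kernel facts `xbCellAny 12 (49/50) la lb c = true` (`decide +kernel`, zero data) for 9 λ-cells of the per-`L` cover
(`…FinXBCover.xbCheck`; cell design: p3 g5 scratch `xb_design.py`, float mirror `xb_mirror.py`); assembled in `…FinXBTwelve`.
Prover seat `hubbard-h0-rotor-p3` g5; helper for piece A = stmt-HubbardSuperconductivity-23918 of rung 19089 (`--supports`, helper class).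
WHAT THIS IS NOT: nothing here proves superconductivity in the Hubbard model (rotor TARGET as worded stays FALSE, g15 verdict); kernel facts for the FIN certificate of ONE hypothesis (row `N₁`) of ONE conditional reduction.  Tree imports only; no sorry, no new axioms.
-/

namespace Summit.HubbardSuperconductivity.HubbardSuperconductivity.Theorems.AnisotropyChord.Transfer.Fibre3

namespace FinXB

set_option maxHeartbeats 4000000 in
/-- kernel fact: cell 31 at `L = 12` (certified, c = (3/10 : ℚ)). [folklore] -/
theorem xb12_31 : xbCellAny 12 (49/50 : ℚ) 1027055665881483 1088679005834373 (3/10 : ℚ) = true := by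
  decide +kernel

set_option maxHeartbeats 4000000 in
/-- kernel fact: cell 32 at `L = 12` (certified, c = (3/10 : ℚ)). [folklore] -/
theorem xb12_32 : xbCellAny 12 (49/50 : ℚ) 1088679005834373 1153999746184436 (3/10 : ℚ) = true := by
  decide +kernel

set_option maxHeartbeats 4000000 in
/-- kernel fact: cell 33 at `L = 12` (certified, c = (3/10 : ℚ)). [folklore] -/
theorem xb12_33 : xbCellAny 12 (49/50 : ℚ) 1153999746184436 1223239730955503 (3/10 : ℚ) = true := by
  decide +kernel

set_option maxHeartbeats 4000000 in
/-- kernel fact: cell 34 at `L = 12` (certified, c = (7/20 : ℚ)). [folklore] -/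
theorem xb12_34 : xbCellAny 12 (49/50 : ℚ) 1223239730955503 1296634114812834 (7/20 : ℚ) = true := by
  decide +kernel

set_option maxHeartbeats 4000000 in
/-- kernel fact: cell 35 at `L = 12` (certified, c = (7/20 : ℚ)). [folklore] -/
theorem xb12_35 : xbCellAny 12 (49/50 : ℚ) 1296634114812834 1374432161701605 (7/20 : ℚ) = true := by
  decide +kernel

set_option maxHeartbeats 4000000 in
/-- kernel fact: cell 36 at `L = 12` (certified, c = (7/20 : ℚ)). [folklore] -/
theorem xb12_36 : xbCellAny 12 (49/50 : ℚ) 1374432161701605 1456898091403702 (7/20 : ℚ) = true := by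
  decide +kernel

set_option maxHeartbeats 4000000 in
/-- kernel fact: cell 37 at `L = 12` (certified, c = (7/20 : ℚ)). [folklore] -/
theorem xb12_37 : xbCellAny 12 (49/50 : ℚ) 1456898091403702 1544311976887925 (7/20 : ℚ) = true := by
  decide +kernel

set_option maxHeartbeats 4000000 in
/-- kernel fact: cell 38 at `L = 12` (certified, c = (7/20 : ℚ)). [folklore] -/
theorem xb12_38 : xbCellAny 12 (49/50 : ℚ) 1544311976887925 1636970695501201 (7/20 : ℚ) = true := by
  decide +kernel

set_option maxHeartbeats 4000000 in
/-- kernel fact: cell 39 at `L = 12` (certified, c = (2/5 : ℚ)). [folklore] -/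
theorem xb12_39 : xbCellAny 12 (49/50 : ℚ) 1636970695501201 1735188937231274 (2/5 : ℚ) = true := by
  decide +kernel

end FinXB

end Summit.HubbardSuperconductivity.HubbardSuperconductivity.Theorems.AnisotropyChord.Transfer.Fibre3
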